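import Literature.Topology.FourManifolds.RadialExtension
import Literature.Geometry.Symplectic.GromovR4RelEndProofs

/-!
# Stub `stub_conePullbackLiouville` of line `contact-isotopy-gromov-cone` for crux `SchoenfliesSplit.SchsplitCerf` (stmt-SmoothPoincare4-8758)

Z1a of the line: for a positive contactomorphism `φ` of the standard contact sphere
`S³ ⊂ (ℝ⁴, ω₀)`, `φ^*α₀ = e^u α₀` with `α₀_z(v) = ½ ω₀(z, v)` (tangent vectors of `S³` read in
`ℝ⁴` through the differential of the inclusion), the rescaled cone
`C(y) = ‖y‖ e^{-u(ŷ)/2} φ(ŷ)` (`ŷ = y/‖y‖ = radialProjection`) pulls the Liouville form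
`λ₀ = ½ ι_x ω₀` back to itself off the origin: `ω₀(C x, DC_x w) = ω₀(x, w)` for `x ≠ 0`.

Proof (Eliashberg's symplectisation of a contactomorphism, Geiges 2008, proof of Prop. 4.11.2):
write `C = c • P` with `c(y) = ‖y‖ e^{-u(π y)/2}` and `P = ι ∘ φ ∘ π`; by the product rule and
`ω₀(P x, P x) = 0`, `ω₀(C x, DC_x w) = c(x)² ω₀(φ(πx), D(ιφ)_{πx}(Dπ_x w))` (manifold chain rule
through Mathlib's `S³`); the contact hypothesis at `z = π x`, `v = Dπ_x w` turns this into
`c² e^{u(πx)} ω₀(πx, D(ι ∘ π)_x w)`, and `ι ∘ π = y ↦ ‖y‖⁻¹ • y` near `x` has differential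
`w ↦ ‖x‖⁻¹ w + (D‖·‖⁻¹_x w) x`, with `ω₀(x, x) = 0`; the scalars cancel:
`‖x‖² e^{-u} e^{u} ‖x‖⁻² = 1`.
-/

noncomputable section

-- the prescribed namespace `Summit.<P>.<Sub>.…` duplicates `SmoothPoincare4` (P = Sub)
set_option linter.dupNamespace false

open scoped Manifold ContDiff Topology
open Set Function Metric
open Literature.Topology.FourManifolds Literature.Geometry.Symplectic

namespace Summit.SmoothPoincare4.SmoothPoincare4.Theorems.SchsplitCerf.ContactIsotopyGromovCone

attribute [local instance] Literature.Topology.FourManifolds.fact_finrank_euclideanSpace_succ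

/-- The unit 3-sphere. -/
local notation "𝕊³" => (Metric.sphere (0 : EuclideanSpace ℝ (Fin 4)) 1)
/-- The model `ℝ⁴`. -/
local notation "E4" => EuclideanSpace ℝ (Fin 4)

namespace ConePullbackLiouville

/-! ### Bilinearity of `ω₀` (through the continuous bilinear packaging `stdSymplecticBilin`) -/

/-- `ω₀(r a, b) = r ω₀(a, b)`. [folklore] -/
theorem omega_smul_left (r : ℝ) (a b : E4) :
    stdSymplecticForm (r • a) b = r * stdSymplecticForm a b := by
  rw [← stdSymplecticBilin_apply, ← stdSymplecticBilin_apply, map_smul, smul_apply, smul_eq_mul]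

/-- `ω₀(a, r b) = r ω₀(a, b)`. [folklore] -/
theorem omega_smul_right (r : ℝ) (a b : E4) :
    stdSymplecticForm a (r • b) = r * stdSymplecticForm a b := by
  rw [← stdSymplecticBilin_apply, ← stdSymplecticBilin_apply, map_smul, smul_eq_mul]

/-- `ω₀(a, b + c) = ω₀(a, b) + ω₀(a, c)`. [folklore] -/
theorem omega_add_right (a b c : E4) :
    stdSymplecticForm a (b + c) = stdSymplecticForm a b + stdSymplecticForm a c := by
  rw [← stdSymplecticBilin_apply, ← stdSymplecticBilin_apply, ← stdSymplecticBilin_apply, map_add]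

/-! ### The radial part: product rule for `C = c • P` and `ω₀(P x, P x) = 0` -/

/-- **Product rule inside `ω₀`.** If `P` has derivative `P'` and the scalar `c` has derivative
`c'` at `x`, then `ω₀(c x • P x, D(c • P)_x w) = c(x)² ω₀(P x, P' w)`: the term
`(c' w) ω₀(P x, P x)` coming from differentiating the scalar vanishes by antisymmetry.
[folklore] -/
theorem omega_smul_fderiv_smul {P : E4 → E4} {c : E4 → ℝ} {P' : E4 →L[ℝ] E4} {c' : E4 →L[ℝ] ℝ}
    {x : E4} (hP : HasFDerivAt P P' x) (hc : HasFDerivAt c c' x) (w : E4) :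
    stdSymplecticForm (c x • P x) (fderiv ℝ (fun y => c y • P y) x w) =
      c x * c x * stdSymplecticForm (P x) (P' w) := by
  rw [(hc.fun_smul hP).fderiv, add_apply, smul_apply,
    ContinuousLinearMap.smulRight_apply, omega_smul_left, omega_add_right, omega_smul_right,
    omega_smul_right, stdSymplecticForm_self]
  ring

/-! ### The tangential part: the differential of `y ↦ y / ‖y‖` inside `ω₀` -/

/-- **Differential of the radial projection read in `ℝ⁴`.** Away from the origin the map
`y ↦ (π y : ℝ⁴)` (`π = radialProjection`) agrees with `y ↦ ‖y‖⁻¹ • y`, whose differential at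
`x` is `w ↦ ‖x‖⁻¹ w + (D(‖·‖⁻¹)_x w) x` (product rule). [folklore] -/
theorem hasFDerivAt_coe_radialProjection {x : E4} (hx : x ≠ 0) :
    HasFDerivAt (fun y : E4 => ((radialProjection (sphereBasePoint 3) y : 𝕊³) : E4))
      (‖x‖⁻¹ • ContinuousLinearMap.id ℝ E4 +
        (fderiv ℝ (fun y : E4 => ‖y‖⁻¹) x).smulRight x) x := by
  have h1 : DifferentiableAt ℝ (fun y : E4 => ‖y‖⁻¹) x :=
    (((contDiffAt_norm (n := ∞) ℝ hx).inv (norm_ne_zero_iff.2 hx)).differentiableAt (by simp) :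
      DifferentiableAt ℝ (fun y : E4 => ‖y‖⁻¹) x)
  have h2 : HasFDerivAt (fun y : E4 => ‖y‖⁻¹ • y)
      (‖x‖⁻¹ • ContinuousLinearMap.id ℝ E4 +
        (fderiv ℝ (fun y : E4 => ‖y‖⁻¹) x).smulRight x) x :=
    h1.hasFDerivAt.fun_smul (hasFDerivAt_id x)
  refine h2.congr_of_eventuallyEq ?_
  filter_upwards [isOpen_ne.mem_nhds hx] with y hy
  exact coe_radialProjection_of_ne_zero _ hy

/-- **`ω₀(x̂, D(ι ∘ π)_x w) = ‖x‖⁻² ω₀(x, w)`** for `x ≠ 0` (`x̂ = x/‖x‖`): the radial term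
`(D(‖·‖⁻¹)_x w) ω₀(x̂, x)` vanishes since `ω₀(x, x) = 0`. [folklore] -/
theorem omega_radialProjection_fderiv {x : E4} (hx : x ≠ 0) (w : E4) :
    stdSymplecticForm ((radialProjection (sphereBasePoint 3) x : 𝕊³) : E4)
        (fderiv ℝ (fun y : E4 => ((radialProjection (sphereBasePoint 3) y : 𝕊³) : E4)) x w) =
      ‖x‖⁻¹ * ‖x‖⁻¹ * stdSymplecticForm x w := by
  rw [(hasFDerivAt_coe_radialProjection hx).fderiv, coe_radialProjection_of_ne_zero _ hx,
    add_apply, smul_apply, ContinuousLinearMap.id_apply,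
    ContinuousLinearMap.smulRight_apply, omega_smul_left, omega_add_right, omega_smul_right,
    omega_smul_right, stdSymplecticForm_self]
  ring

/-! ### The scalar bookkeeping -/

/-- `(‖x‖ e^{-u/2})² · e^{u} · ‖x‖⁻² = 1`, in the shape produced by the main computation.
[folklore] -/
theorem scalar_cancel {r t s : ℝ} (hr : r ≠ 0) :
    r * Real.exp (-t / 2) * (r * Real.exp (-t / 2)) * (Real.exp t * (r⁻¹ * r⁻¹ * s)) = s := by
  have h1 : Real.exp (-t / 2) * Real.exp (-t / 2) * Real.exp t = 1 := by
    rw [← Real.exp_add, ← Real.exp_add, ← Real.exp_zero]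
    congr 1
    ring
  have h2 : r * r⁻¹ = 1 := mul_inv_cancel₀ hr
  calc r * Real.exp (-t / 2) * (r * Real.exp (-t / 2)) * (Real.exp t * (r⁻¹ * r⁻¹ * s))
      = (Real.exp (-t / 2) * Real.exp (-t / 2) * Real.exp t) * ((r * r⁻¹) * (r * r⁻¹)) * s := by
        ring
    _ = s := by rw [h1, h2]; ring

end ConePullbackLiouville

open ConePullbackLiouville in
/-- **Stub Z1a — the rescaled cone of a positive contactomorphism pulls the Liouville form
`λ₀ = ½ ι_x ω₀` back to itself off the origin.**  If `φ^*α₀ = e^u α₀` (`u` smooth,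
`α₀_z(v) = ½ ω₀(z, v)` on `S³ ⊂ (ℝ⁴, ω₀)`, tangent vectors read in `ℝ⁴` through `mfderiv` of the
inclusion) and `C(y) = ‖y‖ e^{-u(ŷ)/2} φ(ŷ)` (`ŷ = radialProjection _ y`), then
`ω₀(C x, DC_x w) = ω₀(x, w)` for every `x ≠ 0` and every `w` (honest `fderiv`).  Proof: write
`C = c • P`, `c(y) = ‖y‖ e^{-u(π y)/2}`, `P = ι ∘ φ ∘ π`; product rule and `ω₀(P x, P x) = 0`
give `ω₀(C x, DC_x w) = c(x)² ω₀(ιφ(πx), D(ιφ)_{πx}(Dπ_x w))` (chain rule `HasMFDerivAt.comp`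
through Mathlib's manifold `S³`); the contact hypothesis at `z = π x` with `v = Dπ_x w` turns
this into `c² e^{u(πx)} ω₀(πx, D(ι ∘ π)_x w)`; finally `ι ∘ π = y ↦ ‖y‖⁻¹ • y` near `x`, whose
differential is `w ↦ ‖x‖⁻¹ w + (D‖·‖⁻¹_x w) x`, and `ω₀(x, x) = 0`, giving
`‖x‖² e^{-u} e^{u} ‖x‖⁻² ω₀(x, w) = ω₀(x, w)`.
[cite: Geiges2008, proof of Prop. 4.11.2 (symplectisation of a contactomorphism)] -/
theorem stub_conePullbackLiouville :
    ∀ (φ : 𝕊³ ≃ₘ⟮𝓡 3, 𝓡 3⟯ 𝕊³) (u : 𝕊³ → ℝ) (C : E4 → E4),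
      ContMDiff (𝓡 3) 𝓘(ℝ, ℝ) ∞ u →
      (∀ (z : 𝕊³) (v : TangentSpace (𝓡 3) z),
        stdSymplecticForm ((φ z : 𝕊³) : E4)
            (mfderiv (𝓡 3) 𝓘(ℝ, E4) (fun w : 𝕊³ => ((φ w : 𝕊³) : E4)) z v) =
          Real.exp (u z) *
            stdSymplecticForm ((z : 𝕊³) : E4)
              (mfderiv (𝓡 3) 𝓘(ℝ, E4) (fun w : 𝕊³ => ((w : 𝕊³) : E4)) z v)) →
      (∀ y : E4, C y =
        (‖y‖ * Real.exp (-(u (radialProjection (sphereBasePoint 3) y)) / 2)) •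
          ((φ (radialProjection (sphereBasePoint 3) y) : 𝕊³) : E4)) →
      ∀ x : E4, x ≠ 0 → ∀ w : E4,
        stdSymplecticForm (C x) (fderiv ℝ C x w) = stdSymplecticForm x w := by
  intro φ u C hu hφ hC x hx w
  obtain rfl : C = fun y : E4 =>
      (‖y‖ * Real.exp (-(u (radialProjection (sphereBasePoint 3) y)) / 2)) •
        ((φ (radialProjection (sphereBasePoint 3) y) : 𝕊³) : E4) := funext hC
  -- smoothness of the constituents at `x ≠ 0`
  have h1 : ContMDiffAt 𝓘(ℝ, E4) (𝓡 3) ∞ (radialProjection (sphereBasePoint 3)) x :=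
    contMDiffAt_radialProjection _ hx
  have hπ : MDifferentiableAt 𝓘(ℝ, E4) (𝓡 3) (radialProjection (sphereBasePoint 3)) x :=
    h1.mdifferentiableAt (by simp)
  have hιφ : MDifferentiableAt (𝓡 3) 𝓘(ℝ, E4) (fun w : 𝕊³ => ((φ w : 𝕊³) : E4))
      (radialProjection (sphereBasePoint 3) x) :=
    (contMDiff_coe_sphere.comp φ.contMDiff).mdifferentiableAt (by simp)
  have hι : MDifferentiableAt (𝓡 3) 𝓘(ℝ, E4) (fun w : 𝕊³ => ((w : 𝕊³) : E4))
      (radialProjection (sphereBasePoint 3) x) :=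
    (contMDiff_coe_sphere (m := ∞)).mdifferentiableAt (by simp)
  -- `P = ι ∘ φ ∘ π` and its differential (manifold chain rule, back to `fderiv` on `ℝ⁴`)
  have hP : HasFDerivAt
      (fun y : E4 => ((φ (radialProjection (sphereBasePoint 3) y) : 𝕊³) : E4))
      ((mfderiv (𝓡 3) 𝓘(ℝ, E4) (fun w : 𝕊³ => ((φ w : 𝕊³) : E4))
          (radialProjection (sphereBasePoint 3) x)).comp
        (mfderiv 𝓘(ℝ, E4) (𝓡 3) (radialProjection (sphereBasePoint 3)) x)) x := by
    have h := HasMFDerivAt.comp x hιφ.hasMFDerivAt hπ.hasMFDerivAt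
    exact hasMFDerivAt_iff_hasFDerivAt.1 h
  -- `ι ∘ π` and its differential
  have hιπ : fderiv ℝ (fun y : E4 => ((radialProjection (sphereBasePoint 3) y : 𝕊³) : E4)) x =
      (mfderiv (𝓡 3) 𝓘(ℝ, E4) (fun w : 𝕊³ => ((w : 𝕊³) : E4))
          (radialProjection (sphereBasePoint 3) x)).comp
        (mfderiv 𝓘(ℝ, E4) (𝓡 3) (radialProjection (sphereBasePoint 3)) x) := by
    have h := (HasMFDerivAt.comp x hι.hasMFDerivAt hπ.hasMFDerivAt).mfderiv
    rw [mfderiv_eq_fderiv] at h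
    exact h
  -- the scalar `c(y) = ‖y‖ e^{-u(π y)/2}` is differentiable at `x`
  have h2 : ContMDiffAt 𝓘(ℝ, E4) 𝓘(ℝ, ℝ) ∞
      (fun y : E4 => u (radialProjection (sphereBasePoint 3) y)) x :=
    hu.contMDiffAt.comp x h1
  have hc : ContDiffAt ℝ ∞
      (fun y : E4 => ‖y‖ * Real.exp (-(u (radialProjection (sphereBasePoint 3) y)) / 2)) x :=
    (contDiffAt_norm ℝ hx).mul ((contMDiffAt_iff_contDiffAt.1 h2).neg.div_const 2).exp
  -- tangential part: `ω₀(π x, D(ι ∘ π)_x w) = ‖x‖⁻² ω₀(x, w)`, read through the chain rule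
  have htan : stdSymplecticForm ((radialProjection (sphereBasePoint 3) x : 𝕊³) : E4)
      (((mfderiv (𝓡 3) 𝓘(ℝ, E4) (fun w : 𝕊³ => ((w : 𝕊³) : E4))
          (radialProjection (sphereBasePoint 3) x)).comp
        (mfderiv 𝓘(ℝ, E4) (𝓡 3) (radialProjection (sphereBasePoint 3)) x)) w) =
      ‖x‖⁻¹ * ‖x‖⁻¹ * stdSymplecticForm x w := by
    have e3 := congrArg (fun L : E4 →L[ℝ] E4 =>
      stdSymplecticForm ((radialProjection (sphereBasePoint 3) x : 𝕊³) : E4) (L w)) hιπ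
    exact e3.symm.trans (omega_radialProjection_fderiv hx w)
  -- the contact hypothesis at `z = π x`, `v = Dπ_x w`, followed by the tangential part
  have key : stdSymplecticForm ((φ (radialProjection (sphereBasePoint 3) x) : 𝕊³) : E4)
      (((mfderiv (𝓡 3) 𝓘(ℝ, E4) (fun w : 𝕊³ => ((φ w : 𝕊³) : E4))
          (radialProjection (sphereBasePoint 3) x)).comp
        (mfderiv 𝓘(ℝ, E4) (𝓡 3) (radialProjection (sphereBasePoint 3)) x)) w) =
      Real.exp (u (radialProjection (sphereBasePoint 3) x)) *
        (‖x‖⁻¹ * ‖x‖⁻¹ * stdSymplecticForm x w) := by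
    have e2 : stdSymplecticForm ((φ (radialProjection (sphereBasePoint 3) x) : 𝕊³) : E4)
        (((mfderiv (𝓡 3) 𝓘(ℝ, E4) (fun w : 𝕊³ => ((φ w : 𝕊³) : E4))
            (radialProjection (sphereBasePoint 3) x)).comp
          (mfderiv 𝓘(ℝ, E4) (𝓡 3) (radialProjection (sphereBasePoint 3)) x)) w) =
        Real.exp (u (radialProjection (sphereBasePoint 3) x)) *
          stdSymplecticForm ((radialProjection (sphereBasePoint 3) x : 𝕊³) : E4)
            (((mfderiv (𝓡 3) 𝓘(ℝ, E4) (fun w : 𝕊³ => ((w : 𝕊³) : E4))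
                (radialProjection (sphereBasePoint 3) x)).comp
              (mfderiv 𝓘(ℝ, E4) (𝓡 3) (radialProjection (sphereBasePoint 3)) x)) w) :=
      hφ (radialProjection (sphereBasePoint 3) x)
        (mfderiv 𝓘(ℝ, E4) (𝓡 3) (radialProjection (sphereBasePoint 3)) x w)
    exact e2.trans (congrArg (fun s => Real.exp (u (radialProjection (sphereBasePoint 3) x)) * s)
      htan)
  -- radial part (product rule, `ω₀(P x, P x) = 0`) and the scalar bookkeeping
  calc stdSymplecticForm
        ((fun y : E4 =>
          (‖y‖ * Real.exp (-(u (radialProjection (sphereBasePoint 3) y)) / 2)) •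
            ((φ (radialProjection (sphereBasePoint 3) y) : 𝕊³) : E4)) x)
        (fderiv ℝ (fun y : E4 =>
          (‖y‖ * Real.exp (-(u (radialProjection (sphereBasePoint 3) y)) / 2)) •
            ((φ (radialProjection (sphereBasePoint 3) y) : 𝕊³) : E4)) x w)
      = ‖x‖ * Real.exp (-(u (radialProjection (sphereBasePoint 3) x)) / 2) *
          (‖x‖ * Real.exp (-(u (radialProjection (sphereBasePoint 3) x)) / 2)) *
          stdSymplecticForm ((φ (radialProjection (sphereBasePoint 3) x) : 𝕊³) : E4)
            (((mfderiv (𝓡 3) 𝓘(ℝ, E4) (fun w : 𝕊³ => ((φ w : 𝕊³) : E4))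
                (radialProjection (sphereBasePoint 3) x)).comp
              (mfderiv 𝓘(ℝ, E4) (𝓡 3) (radialProjection (sphereBasePoint 3)) x)) w) :=
        omega_smul_fderiv_smul hP (hc.differentiableAt (by simp)).hasFDerivAt w
    _ = ‖x‖ * Real.exp (-(u (radialProjection (sphereBasePoint 3) x)) / 2) *
          (‖x‖ * Real.exp (-(u (radialProjection (sphereBasePoint 3) x)) / 2)) *
          (Real.exp (u (radialProjection (sphereBasePoint 3) x)) *
            (‖x‖⁻¹ * ‖x‖⁻¹ * stdSymplecticForm x w)) := by rw [key]
    _ = stdSymplecticForm x w := scalar_cancel (norm_ne_zero_iff.2 hx)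

end Summit.SmoothPoincare4.SmoothPoincare4.Theorems.SchsplitCerf.ContactIsotopyGromovCone

end
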